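import Summits.CriticalPhenomena.PercolationContinuityZ3.Theorems.PercNearOneGluingNoHeavyLowerTailHullPortTANWithinPrelim
import Summits.CriticalPhenomena.PercolationContinuityZ3.Theorems.PercNearOneGluingNoHeavyLowerTailHullPortTANSetObsEdge
import HarnessLib

/-!
# `NoHeavyLowerTail` (stmt-CriticalPhenomena-4575) — set-observer marker dominance: the averaged one-step covariance is `≥ 0`

Support file (prover `prim-hp-7`; `--supports stmt-CriticalPhenomena-4575`); no definitions, named facts or sorries.
Blueprint steps B3–B4 (prim-cplus-coupling A5-COUPLING-gen13.md §4 (4c)–(4d); prim-hp-7 FROM-prim-hp-7-g29-REFEREE-MDLSET.md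
§2–§3), part 2 — the hypothesis of prim-lit-3's reduction theorem for the set-observer test function
`h = b · ζ̄_N − a^N · 1{y ∈ V(C_s)}` (`b = tab = μ(y ↮ s, X)`, `a^N = taaN = μ(y ↮ s,X; y ↔ N; N ↮ s,X)`):
* `HullPort.condCov_chi_eq_taC` — the one-step conditional covariance of `g(C_s)` with `1{s ↔ y}` given `C_X` is the
  functional `c(ω) = taC` of `…HullPortTADefs`;
* `HullPort.setObs_condCov_ge` — per configuration, in `G − cut_X(ω)`: `(taNWN/taN)·c ≤ 1{N ↮ X}·Cov(g(C_s), 1{s↔N} | C_X)`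
  (the set-observer covariance comparison `HullPort.setObs_cov_ge_edge_sum` for the zeroed weights, and Harris when
  `μ_{G−K̄}(s ↮ y) = 0`);
* `HullPort.covD_lin` — bilinearity bookkeeping;
* `HullPort.withinD_setObs_nonneg` — **`R(g) = E[Cov(g(C_s), h(C_s) | C_X); D] ≥ 0`** for all weights `< 1` and monotone
  `g ≥ 0`: by the two one-step decompositions (`covD_eq_withinD_add` for `h`, and (I)–(III) of `…TANWithinPrelim` for
  `ζ_N`), `μ(D)·R(g) ≥ μ(D)·Σ_ω w 1_D [b·1{N↮X}·Cov(g,1{s↔N}|C_X) − a^N·Cov(g,1{s↔y}|C_X)] ≥ μ(D)·Q^N(g)/…`, i.e. at least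
  the set-observer `T_A` functional `taQN ≥ 0` (`HullPort.taQN_nonneg`, B2).
[cite: VandenbergHaggstromKahn2005, §1 pp. 6–8, §2.1 pp. 10–13 (Lemma 2.4, the chain, Remark 2.8) — corollaries]
[cite: KozmaNitzan2024, Question 9 (p. 36)]
-/

noncomputable section

namespace Summit.CriticalPhenomena.PercolationContinuityZ3.Theorems

open MeasureTheory Set Literature.Probability.LatticeModels Literature.Probability.Percolation
open scoped Classical

variable {V : Type*}

namespace HullPort

open LonePortSum LonePortSumGeneral BHK2006 DecisionTree KNPreFKG

section TANWithin

variable [Fintype V]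

omit [Fintype V] in
/-- `1{y ∈ {s} ∪ V(C_s)}` read on the configuration is `1{s ↔ y}`. [folklore] -/
theorem ind_chiSet_openEdgeCluster (s y : V) (ξ : Set (Sym2 V)) :
    ind {A : Set (Sym2 V) | y = s ∨ ∃ e ∈ A, y ∈ e} (openEdgeCluster ξ s) = ind (openConn s y) ξ := by
  have key : openEdgeCluster ξ s ∈ {A : Set (Sym2 V) | y = s ∨ ∃ e ∈ A, y ∈ e} ↔ ξ ∈ openConn s y :=
    (reachable_iff_exists_mem_openEdgeCluster ξ s y).symm
  by_cases h : ξ ∈ openConn s y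
  · rw [ind_of_mem h, ind_of_mem (key.2 h)]
  · rw [ind_of_not_mem h, ind_of_not_mem fun h' => h (key.1 h')]

/-- **`Cov(g(C_s), 1{s ↔ y} | C_X = C_X(ω)) = c(ω)`**: the one-step conditional covariance of BHK's chain (`condCov`,
pairs meeting `X ∪ V(C_X)` deleted) is the functional `taC` (pairs of `cut X ω` deleted). [folklore] -/
theorem condCov_chi_eq_taC (w : Sym2 V → ℝ) (s y : V) (X : Set V) (g : Set (Sym2 V) → ℝ) (ω : Set (Sym2 V)) :
    condCov w {s} X g (ind {A : Set (Sym2 V) | y = s ∨ ∃ e ∈ A, y ∈ e}) (setCl ω X) = taC w s y X g ω := by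
  have hbar : barOf X (setCl ω X) = cut X ω := barOf_setCl_eq ω X
  simp only [condCov, condS, halfS, taC, delE, hbar, setCl_singleton, ind_chiSet_openEdgeCluster]

/-- **The set-observer covariance comparison in `G − cut_X(ω)`**: for monotone `g ≥ 0`,
`(taNWN/taN)(ω) · c(ω) ≤ 1{C_X(ω) ∈ missN N X} · Cov(g(C_s), 1{C_s ∈ hitN s N} | C_X = C_X(ω))` — i.e.
`μ_K(y↔N, N↮s | s↮y) · Cov_K(g, 1{s↔y}) ≤ Cov_K(g, 1{s↔N})` in `K = G − cut_X(ω)` when `N` misses the cluster of `X`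
(`setObs_cov_ge_edge_sum` for the weights zeroed on `cut X ω`; Harris when `μ_K(s ↮ y) = 0`), and `0 ≤ 0` otherwise.
[cite: VandenbergHaggstromKahn2005, Thms 1.4–1.5 (p. 7), §1 p. 6 (Harris) — corollary] -/
theorem setObs_condCov_ge (p : Sym2 V → unitInterval) (s y : V) (hsy : s ≠ y) (N X : Set V)
    (g : Set (Sym2 V) → ℝ) (hg : Monotone g) (hg0 : ∀ C, 0 ≤ g C) (ω : Set (Sym2 V)) :
    taNWN (fun e => (p e : ℝ)) s y N X ω / taN (fun e => (p e : ℝ)) s y X ω * taC (fun e => (p e : ℝ)) s y X g ω ≤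
      ind (missN N X) (setCl ω X) *
        condCov (fun e => (p e : ℝ)) {s} X g (ind (hitN s N)) (setCl ω X) := by
  classical
  set w : Sym2 V → ℝ := fun e => (p e : ℝ) with hw
  set B₀ : Set (Sym2 V) := cut X ω with hB₀
  -- the zeroed weights
  set q : Sym2 V → unitInterval := fun e => if e ∈ B₀ then 0 else p e with hq
  set wq : Sym2 V → ℝ := fun e => (q e : ℝ) with hwq
  have hwq' : wq = fun i => if i ∈ B₀ then 0 else w i := by
    funext e
    simp only [hwq, hq, hw]
    split_ifs <;> rfl
  have hq0 : ∀ e, 0 ≤ wq e := fun e => (q e).2.1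
  have hq1 : ∀ e, wq e ≤ 1 := fun e => (q e).2.2
  have hmq : ∑ η, weight wq η = 1 := by
    have h1 := integral_prodBernoulli_eq_sum q fun _ => (1 : ℝ)
    simp only [integral_const, probReal_univ, smul_eq_mul, mul_one] at h1
    exact h1.symm
  have hdel : ∀ φ : Set (Sym2 V) → ℝ, delE w B₀ φ = ∑ η, weight wq η * φ η := by
    intro φ
    rw [delE, sum_weight_mul_comp_sdiff w B₀ φ, hwq']
  -- the pieces
  have hbar : barOf X (setCl ω X) = B₀ := barOf_setCl_eq ω X
  have hcc : condCov w {s} X g (ind (hitN s N)) (setCl ω X) =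
      (∑ η, weight wq η * (g (openEdgeCluster η s) * ind (connS N s) η)) -
        (∑ η, weight wq η * g (openEdgeCluster η s)) * ∑ η, weight wq η * ind (connS N s) η := by
    have e1 : condS w {s} X (fun A => g A * ind (hitN s N) A) (setCl ω X) =
        delE w B₀ (fun η => g (openEdgeCluster η s) * ind (connS N s) η) := by
      simp only [condS, halfS, delE, hbar, setCl_singleton, ind_hitN_openEdgeCluster]
    have e2 : condS w {s} X g (setCl ω X) = delE w B₀ (fun η => g (openEdgeCluster η s)) := by
      simp only [condS, halfS, delE, hbar, setCl_singleton]
    have e3 : condS w {s} X (ind (hitN s N)) (setCl ω X) = delE w B₀ (fun η => ind (connS N s) η) := by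
      simp only [condS, halfS, delE, hbar, setCl_singleton, ind_hitN_openEdgeCluster]
    rw [condCov, e1, e2, e3, hdel, hdel, hdel]
  have hC : taC w s y X g ω = (∑ η, weight wq η * (g (openEdgeCluster η s) * ind (openConn s y) η)) -
      (∑ η, weight wq η * g (openEdgeCluster η s)) * ∑ η, weight wq η * ind (openConn s y) η := by
    rw [taC, hdel, hdel, hdel]
  have hNn : taN w s y X ω = ∑ η, weight wq η * ind (openConn s y : Set (BondConfig V))ᶜ η := by
    rw [taN, hdel]
  have hE : delE w B₀ (ind ((openConn s y : Set (BondConfig V))ᶜ ∩ (connS N y ∩ sepEv N {s}))) =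
      ∑ η, weight wq η * ind ((openConn s y : Set (BondConfig V))ᶜ ∩ (connS N y ∩ sepEv N {s})) η := hdel _
  -- B1 for the zeroed weights, and Harris
  have hB1 := setObs_cov_ge_edge_sum q s y N hsy g hg
  have hgm : Monotone fun η : Set (Sym2 V) => g (openEdgeCluster η s) := fun η η' h => hg (openEdgeCluster_mono h s)
  have hcm : Monotone fun η : Set (Sym2 V) => ind (connS N s) η := by
    intro η η' hle
    have hup : IsUpperSet (connS N s : Set (Set (Sym2 V))) := by
      intro a b hab ha
      obtain ⟨n, hn, hr⟩ := ha
      exact ⟨n, hn, hr.mono (openGraph_le hab)⟩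
    show ind (connS N s) η ≤ ind (connS N s) η'
    by_cases h1 : η ∈ connS N s
    · rw [ind_of_mem h1, ind_of_mem (hup hle h1)]
    · rw [ind_of_not_mem h1]; exact ind_nonneg _ _
  have hH := harris hq0 hq1 (fun η => hg0 _) (fun η => ind_nonneg _ _) hgm hcm
  rw [hmq, one_mul] at hH
  have hcc0 : 0 ≤ condCov w {s} X g (ind (hitN s N)) (setCl ω X) := by rw [hcc]; linarith
  -- case analysis on `1{N ↮ X}` and on `taN = 0`
  have hkN : ind (missN N X) (setCl ω X) = ind (avoidCut N) (cut X ω) := by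
    rw [ind_missN_setCl, ind_avoidCut_cut]
  rw [hkN, taNWN]
  by_cases hA : cut X ω ∈ avoidCut N
  · rw [ind_of_mem hA, one_mul, one_mul]
    have hN0 : 0 ≤ taN w s y X ω := by
      rw [hNn]; exact Finset.sum_nonneg fun η _ => mul_nonneg (weight_nonneg hq0 hq1 η) (ind_nonneg _ _)
    by_cases hz : taN w s y X ω = 0
    · rw [hz, div_zero, zero_mul]; exact hcc0
    · have hpos : 0 < taN w s y X ω := lt_of_le_of_ne hN0 (Ne.symm hz)
      rw [div_mul_eq_mul_div, div_le_iff₀ hpos]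
      rw [hE, hC, hcc, hNn]
      show _ ≤ _
      nlinarith [hB1]
  · rw [ind_of_not_mem hA, zero_mul, zero_mul, zero_div, zero_mul]

/-- Bilinearity bookkeeping: `cov_D(φ, a h₁ − b h₂) = a cov_D(φ, h₁) − b cov_D(φ, h₂)`. [folklore] -/
theorem covD_lin (w : Sym2 V → ℝ) (S : Set V) (D : Set (Set (Sym2 V))) (φ h₁ h₂ : Set (Sym2 V) → ℝ) (a b : ℝ) :
    covD w S D φ (fun A => a * h₁ A - b * h₂ A) = a * covD w S D φ h₁ - b * covD w S D φ h₂ := by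
  have e1 : ∑ ω, weight w ω * (φ (setCl ω S) * (a * h₁ (setCl ω S) - b * h₂ (setCl ω S)) * ind D ω) =
      a * ∑ ω, weight w ω * (φ (setCl ω S) * h₁ (setCl ω S) * ind D ω) -
        b * ∑ ω, weight w ω * (φ (setCl ω S) * h₂ (setCl ω S) * ind D ω) := by
    rw [Finset.mul_sum, Finset.mul_sum, ← Finset.sum_sub_distrib]
    exact Finset.sum_congr rfl fun ω _ => by ring
  have e2 : ∑ ω, weight w ω * ((a * h₁ (setCl ω S) - b * h₂ (setCl ω S)) * ind D ω) =
      a * ∑ ω, weight w ω * (h₁ (setCl ω S) * ind D ω) - b * ∑ ω, weight w ω * (h₂ (setCl ω S) * ind D ω) := by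
    rw [Finset.mul_sum, Finset.mul_sum, ← Finset.sum_sub_distrib]
    exact Finset.sum_congr rfl fun ω _ => by ring
  simp only [covD]
  rw [e1, e2]
  ring

/-- **The hypothesis of the reduction theorem for the set-observer test function.**  For all weights `< 1`, `s ≠ y`,
every avoided set `X`, observer set `N` and monotone `g ≥ 0`, with `D = {s ↮ X}`, `b = μ(y ↮ s, X)` (`tab`),
`a^N = μ(y ↮ s,X; y ↔ N; N ↮ s,X)` (`taaN`) and `h = b · ζ̄_N − a^N · 1{y ∈ V(·)}`:
`withinD(g, h) = E[Cov(g(C_s), h(C_s) | C_X); D] ≥ 0`.  Proof: `μ(D)·withinD(g,h) = cov_D(g,h) − cov_D(𝑇g,h)`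
(`covD_eq_withinD_add`); the `ζ̄`-part of the right-hand side is, by (I)–(III) of `…TANWithinPrelim`, at least
`μ(D)·Σ_ω w 1_D 1{N↮X} Cov(g, 1{s↔N} | C_X)`, the `1{y}`-part equals `μ(D)·Σ_ω w 1_D Cov(g, 1{s↔y} | C_X)`; by
`setObs_condCov_ge` and `condCov_chi_eq_taC` the combination dominates `Q^N = taQN ≥ 0` (`taQN_nonneg`).
(cell memos prim-cplus-coupling A5-COUPLING-gen13.md §4 (4c)–(4d), prim-hp-7 FROM-prim-hp-7-g29-REFEREE-MDLSET.md §2–§3)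
[cite: VandenbergHaggstromKahn2005, §2.1 pp. 10–13 — corollaries] -/
theorem withinD_setObs_nonneg (p : Sym2 V → unitInterval) (hp : ∀ e, (p e : ℝ) < 1) (s y : V) (hsy : s ≠ y)
    (N X : Set V) (g : Set (Sym2 V) → ℝ) (hg : Monotone g) (hg0 : ∀ C, 0 ≤ g C) :
    0 ≤ withinD (fun e => (p e : ℝ)) {s} X (avoidEv s X) g
      (fun A => tab (fun e => (p e : ℝ)) s y X * zetaBarN (fun e => (p e : ℝ)) s N X A - taaN (fun e => (p e : ℝ)) s y N X * (ind {A : Set (Sym2 V) | y = s ∨ ∃ e ∈ A, y ∈ e}) A) := by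
  classical
  have hw0 : ∀ e, 0 ≤ (fun e => (p e : ℝ)) e := fun e => (p e).2.1
  have hw1 : ∀ e, (fun e => (p e : ℝ)) e ≤ 1 := fun e => (p e).2.2
  have hm : ∑ ω, weight (fun e => (p e : ℝ)) ω = 1 := by
    have h1 := integral_prodBernoulli_eq_sum p fun _ => (1 : ℝ)
    simp only [integral_const, probReal_univ, smul_eq_mul, mul_one] at h1
    exact h1.symm
  have hD := mem_avoidEv_iff_two s X
  have hcE0 : 0 ≤ tab (fun e => (p e : ℝ)) s y X :=
    Finset.sum_nonneg fun ω _ => mul_nonneg (weight_nonneg hw0 hw1 ω) (ind_nonneg _ _)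
  have hμD0 : 0 ≤ (∑ ω, weight (fun e => (p e : ℝ)) ω * ind (avoidEv s X) ω) :=
    Finset.sum_nonneg fun ω _ => mul_nonneg (weight_nonneg hw0 hw1 ω) (ind_nonneg _ _)
  by_cases hμDz : (∑ ω, weight (fun e => (p e : ℝ)) ω * ind (avoidEv s X) ω) = 0
  · -- `D` is null: every term vanishes
    have hz : ∀ ω, weight (fun e => (p e : ℝ)) ω * ind (avoidEv s X) ω = 0 := fun ω =>
      (Finset.sum_eq_zero_iff_of_nonneg (fun ω _ => mul_nonneg (weight_nonneg hw0 hw1 ω) (ind_nonneg _ _))).1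
        hμDz ω (Finset.mem_univ ω)
    have : withinD (fun e => (p e : ℝ)) {s} X (avoidEv s X) g (fun A => tab (fun e => (p e : ℝ)) s y X * zetaBarN (fun e => (p e : ℝ)) s N X A - taaN (fun e => (p e : ℝ)) s y N X * (ind {A : Set (Sym2 V) | y = s ∨ ∃ e ∈ A, y ∈ e}) A) = 0 := by
      rw [withinD]
      refine Finset.sum_eq_zero fun ω _ => ?_
      have := hz ω
      calc weight (fun e => (p e : ℝ)) ω * (condCov (fun e => (p e : ℝ)) {s} X g (fun A => tab (fun e => (p e : ℝ)) s y X * zetaBarN (fun e => (p e : ℝ)) s N X A - taaN (fun e => (p e : ℝ)) s y N X * (ind {A : Set (Sym2 V) | y = s ∨ ∃ e ∈ A, y ∈ e}) A) (setCl ω X) * ind (avoidEv s X) ω)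
          = condCov (fun e => (p e : ℝ)) {s} X g (fun A => tab (fun e => (p e : ℝ)) s y X * zetaBarN (fun e => (p e : ℝ)) s N X A - taaN (fun e => (p e : ℝ)) s y N X * (ind {A : Set (Sym2 V) | y = s ∨ ∃ e ∈ A, y ∈ e}) A) (setCl ω X) * (weight (fun e => (p e : ℝ)) ω * ind (avoidEv s X) ω) := by ring
        _ = 0 := by rw [this, mul_zero]
    rw [this]
  have hμDpos : 0 < (∑ ω, weight (fun e => (p e : ℝ)) ω * ind (avoidEv s X) ω) := lt_of_le_of_ne hμD0 (Ne.symm hμDz)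
  -- (0) the one-step decompositions for `h` and for `χ = 1{y ∈ V(·)}`
  have dec := covD_eq_withinD_add (fun e => (p e : ℝ)) hm {s} X hD g (fun A => tab (fun e => (p e : ℝ)) s y X * zetaBarN (fun e => (p e : ℝ)) s N X A - taaN (fun e => (p e : ℝ)) s y N X * (ind {A : Set (Sym2 V) | y = s ∨ ∃ e ∈ A, y ∈ e}) A)
  have decχ := covD_eq_withinD_add (fun e => (p e : ℝ)) hm {s} X hD g (ind {A : Set (Sym2 V) | y = s ∨ ∃ e ∈ A, y ∈ e})
  -- the shape of `covD` with the vertex cluster written as `openEdgeCluster`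
  have covD_eq : ∀ φ ψ : Set (Sym2 V) → ℝ, covD (fun e => (p e : ℝ)) {s} (avoidEv s X) φ ψ =
      (∑ ω, weight (fun e => (p e : ℝ)) ω * ind (avoidEv s X) ω) * (∑ ω, weight (fun e => (p e : ℝ)) ω * (φ (openEdgeCluster ω s) * ψ (openEdgeCluster ω s) * ind (avoidEv s X) ω)) -
        (∑ ω, weight (fun e => (p e : ℝ)) ω * (φ (openEdgeCluster ω s) * ind (avoidEv s X) ω)) *
          ∑ ω, weight (fun e => (p e : ℝ)) ω * (ψ (openEdgeCluster ω s) * ind (avoidEv s X) ω) := by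
    intro φ ψ; simp only [covD, setCl_singleton]
  -- (I): `E[φ ζ̄ 1_D] = E[φ 1{hitN} 1{missN} 1_D]`
  have tI : ∀ φ : Set (Sym2 V) → ℝ,
      ∑ ω, weight (fun e => (p e : ℝ)) ω * (φ (openEdgeCluster ω s) * zetaBarN (fun e => (p e : ℝ)) s N X (openEdgeCluster ω s) * ind (avoidEv s X) ω) =
        ∑ ω, weight (fun e => (p e : ℝ)) ω * (φ (openEdgeCluster ω s) *
          ((ind (hitN s N)) (openEdgeCluster ω s) * (ind (missN N X)) (setCl ω X)) * ind (avoidEv s X) ω) :=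
    fun φ => (zetaN_towerS p s N X φ).symm
  have tI1 : ∑ ω, weight (fun e => (p e : ℝ)) ω * (zetaBarN (fun e => (p e : ℝ)) s N X (openEdgeCluster ω s) * ind (avoidEv s X) ω) =
      ∑ ω, weight (fun e => (p e : ℝ)) ω * (((ind (hitN s N)) (openEdgeCluster ω s) * (ind (missN N X)) (setCl ω X)) * ind (avoidEv s X) ω) := by
    have := tI fun _ => 1
    simpa only [one_mul] using this
  -- (II) instances
  have tII1 : ∑ ω, weight (fun e => (p e : ℝ)) ω * (g (openEdgeCluster ω s) *
      ((ind (hitN s N)) (openEdgeCluster ω s) * (ind (missN N X)) (setCl ω X)) * ind (avoidEv s X) ω) =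
      ∑ ω, weight (fun e => (p e : ℝ)) ω * ((ind (missN N X)) (setCl ω X) *
        condS (fun e => (p e : ℝ)) {s} X (fun A => g A * (ind (hitN s N)) A) (setCl ω X) * ind (avoidEv s X) ω) := by
    have := zetaN_condX p s X (fun A => g A * (ind (hitN s N)) A) (ind (missN N X))
    rw [← this]
    exact Finset.sum_congr rfl fun ω _ => by ring
  have tII2 : ∑ ω, weight (fun e => (p e : ℝ)) ω * (g (openEdgeCluster ω s) * ind (avoidEv s X) ω) =
      ∑ ω, weight (fun e => (p e : ℝ)) ω * (condS (fun e => (p e : ℝ)) {s} X g (setCl ω X) * ind (avoidEv s X) ω) := by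
    have := zetaN_condX p s X g (fun _ => 1)
    simpa only [mul_one, one_mul] using this
  have tII3 : ∑ ω, weight (fun e => (p e : ℝ)) ω * (((ind (hitN s N)) (openEdgeCluster ω s) * (ind (missN N X)) (setCl ω X)) * ind (avoidEv s X) ω) =
      ∑ ω, weight (fun e => (p e : ℝ)) ω * ((ind (missN N X)) (setCl ω X) * condS (fun e => (p e : ℝ)) {s} X (ind (hitN s N)) (setCl ω X) * ind (avoidEv s X) ω) :=
    zetaN_condX p s X (ind (hitN s N)) (ind (missN N X))
  have tII4 : ∑ ω, weight (fun e => (p e : ℝ)) ω * (condS (fun e => (p e : ℝ)) {s} X g (setCl ω X) *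
      ((ind (hitN s N)) (openEdgeCluster ω s) * (ind (missN N X)) (setCl ω X)) * ind (avoidEv s X) ω) =
      ∑ ω, weight (fun e => (p e : ℝ)) ω * (((ind (missN N X)) (setCl ω X) * condS (fun e => (p e : ℝ)) {s} X g (setCl ω X)) *
        condS (fun e => (p e : ℝ)) {s} X (ind (hitN s N)) (setCl ω X) * ind (avoidEv s X) ω) := by
    have := zetaN_condX p s X (ind (hitN s N)) (fun B => (ind (missN N X)) B * condS (fun e => (p e : ℝ)) {s} X g B)
    rw [← this]
    exact Finset.sum_congr rfl fun ω _ => by ring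
  -- (III)
  have tIII := zetaN_harrisS p s N X g hg
  rw [tI (gibbsT (fun e => (p e : ℝ)) {s} X g)] at tIII
  -- `E[(𝑇g)(C_s) 1_D] = E[(Ag)(C_X) 1_D]`
  have e6 : ∑ ω, weight (fun e => (p e : ℝ)) ω * ((gibbsT (fun e => (p e : ℝ)) {s} X g) (openEdgeCluster ω s) * ind (avoidEv s X) ω) =
      ∑ ω, weight (fun e => (p e : ℝ)) ω * (condS (fun e => (p e : ℝ)) {s} X g (setCl ω X) * ind (avoidEv s X) ω) := by
    have := (set_sum_cond_cluster (fun e => (p e : ℝ)) hm {s} X (fun _ B => condS (fun e => (p e : ℝ)) {s} X g B) hD).symm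
    simp only [setCl_singleton] at this
    rw [← this]
    refine Finset.sum_congr rfl fun ω _ => ?_
    simp only [gibbsT, halfT, barOf_singleton_eq]
  -- the ζ̄-part
  have hZ : covD (fun e => (p e : ℝ)) {s} (avoidEv s X) g (zetaBarN (fun e => (p e : ℝ)) s N X) - covD (fun e => (p e : ℝ)) {s} (avoidEv s X) (gibbsT (fun e => (p e : ℝ)) {s} X g) (zetaBarN (fun e => (p e : ℝ)) s N X) ≥
      (∑ ω, weight (fun e => (p e : ℝ)) ω * ind (avoidEv s X) ω) * ∑ ω, weight (fun e => (p e : ℝ)) ω *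
        ((ind (missN N X)) (setCl ω X) * condCov (fun e => (p e : ℝ)) {s} X g (ind (hitN s N)) (setCl ω X) * ind (avoidEv s X) ω) := by
    rw [covD_eq, covD_eq, tI g, tI (gibbsT (fun e => (p e : ℝ)) {s} X g), tI1, tII1, tII2, tII3, e6]
    have h3 : (∑ ω, weight (fun e => (p e : ℝ)) ω * ind (avoidEv s X) ω) * ∑ ω, weight (fun e => (p e : ℝ)) ω * ((gibbsT (fun e => (p e : ℝ)) {s} X g) (openEdgeCluster ω s) *
        ((ind (hitN s N)) (openEdgeCluster ω s) * (ind (missN N X)) (setCl ω X)) * ind (avoidEv s X) ω) ≤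
        (∑ ω, weight (fun e => (p e : ℝ)) ω * ind (avoidEv s X) ω) * ∑ ω, weight (fun e => (p e : ℝ)) ω * (((ind (missN N X)) (setCl ω X) * condS (fun e => (p e : ℝ)) {s} X g (setCl ω X)) *
          condS (fun e => (p e : ℝ)) {s} X (ind (hitN s N)) (setCl ω X) * ind (avoidEv s X) ω) := by
      rw [← tII4]
      exact mul_le_mul_of_nonneg_left tIII hμD0
    have hR : ∑ ω, weight (fun e => (p e : ℝ)) ω *
        ((ind (missN N X)) (setCl ω X) * condCov (fun e => (p e : ℝ)) {s} X g (ind (hitN s N)) (setCl ω X) * ind (avoidEv s X) ω) =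
        (∑ ω, weight (fun e => (p e : ℝ)) ω * ((ind (missN N X)) (setCl ω X) *
          condS (fun e => (p e : ℝ)) {s} X (fun A => g A * (ind (hitN s N)) A) (setCl ω X) * ind (avoidEv s X) ω)) -
          ∑ ω, weight (fun e => (p e : ℝ)) ω * (((ind (missN N X)) (setCl ω X) * condS (fun e => (p e : ℝ)) {s} X g (setCl ω X)) *
            condS (fun e => (p e : ℝ)) {s} X (ind (hitN s N)) (setCl ω X) * ind (avoidEv s X) ω) := by
      rw [← Finset.sum_sub_distrib]
      exact Finset.sum_congr rfl fun ω _ => by rw [condCov]; ring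
    rw [hR]
    nlinarith [h3]
  -- the χ-part
  have hX : covD (fun e => (p e : ℝ)) {s} (avoidEv s X) g (ind {A : Set (Sym2 V) | y = s ∨ ∃ e ∈ A, y ∈ e}) - covD (fun e => (p e : ℝ)) {s} (avoidEv s X) (gibbsT (fun e => (p e : ℝ)) {s} X g) (ind {A : Set (Sym2 V) | y = s ∨ ∃ e ∈ A, y ∈ e}) =
      (∑ ω, weight (fun e => (p e : ℝ)) ω * ind (avoidEv s X) ω) * ∑ ω, weight (fun e => (p e : ℝ)) ω * (condCov (fun e => (p e : ℝ)) {s} X g (ind {A : Set (Sym2 V) | y = s ∨ ∃ e ∈ A, y ∈ e}) (setCl ω X) * ind (avoidEv s X) ω) := by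
    rw [decχ, withinD]; ring
  -- combine
  have hlin1 := covD_lin (fun e => (p e : ℝ)) {s} (avoidEv s X) g (zetaBarN (fun e => (p e : ℝ)) s N X) (ind {A : Set (Sym2 V) | y = s ∨ ∃ e ∈ A, y ∈ e}) (tab (fun e => (p e : ℝ)) s y X) (taaN (fun e => (p e : ℝ)) s y N X)
  have hlin2 := covD_lin (fun e => (p e : ℝ)) {s} (avoidEv s X) (gibbsT (fun e => (p e : ℝ)) {s} X g) (zetaBarN (fun e => (p e : ℝ)) s N X) (ind {A : Set (Sym2 V) | y = s ∨ ∃ e ∈ A, y ∈ e}) (tab (fun e => (p e : ℝ)) s y X) (taaN (fun e => (p e : ℝ)) s y N X)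
  have key : (∑ ω, weight (fun e => (p e : ℝ)) ω * ind (avoidEv s X) ω) * withinD (fun e => (p e : ℝ)) {s} X (avoidEv s X) g (fun A => tab (fun e => (p e : ℝ)) s y X * zetaBarN (fun e => (p e : ℝ)) s N X A - taaN (fun e => (p e : ℝ)) s y N X * (ind {A : Set (Sym2 V) | y = s ∨ ∃ e ∈ A, y ∈ e}) A) ≥ (∑ ω, weight (fun e => (p e : ℝ)) ω * ind (avoidEv s X) ω) * ∑ ω, weight (fun e => (p e : ℝ)) ω *
      ((tab (fun e => (p e : ℝ)) s y X * (ind (missN N X)) (setCl ω X) * condCov (fun e => (p e : ℝ)) {s} X g (ind (hitN s N)) (setCl ω X) -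
        taaN (fun e => (p e : ℝ)) s y N X * condCov (fun e => (p e : ℝ)) {s} X g (ind {A : Set (Sym2 V) | y = s ∨ ∃ e ∈ A, y ∈ e}) (setCl ω X)) * ind (avoidEv s X) ω) := by
    have e0 : (∑ ω, weight (fun e => (p e : ℝ)) ω * ind (avoidEv s X) ω) * withinD (fun e => (p e : ℝ)) {s} X (avoidEv s X) g (fun A => tab (fun e => (p e : ℝ)) s y X * zetaBarN (fun e => (p e : ℝ)) s N X A - taaN (fun e => (p e : ℝ)) s y N X * (ind {A : Set (Sym2 V) | y = s ∨ ∃ e ∈ A, y ∈ e}) A) =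
        covD (fun e => (p e : ℝ)) {s} (avoidEv s X) g (fun A => tab (fun e => (p e : ℝ)) s y X * zetaBarN (fun e => (p e : ℝ)) s N X A - taaN (fun e => (p e : ℝ)) s y N X * (ind {A : Set (Sym2 V) | y = s ∨ ∃ e ∈ A, y ∈ e}) A) - covD (fun e => (p e : ℝ)) {s} (avoidEv s X) (gibbsT (fun e => (p e : ℝ)) {s} X g) (fun A => tab (fun e => (p e : ℝ)) s y X * zetaBarN (fun e => (p e : ℝ)) s N X A - taaN (fun e => (p e : ℝ)) s y N X * (ind {A : Set (Sym2 V) | y = s ∨ ∃ e ∈ A, y ∈ e}) A) := by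
      rw [dec]; ring
    have esplit : ∑ ω, weight (fun e => (p e : ℝ)) ω *
        ((tab (fun e => (p e : ℝ)) s y X * (ind (missN N X)) (setCl ω X) * condCov (fun e => (p e : ℝ)) {s} X g (ind (hitN s N)) (setCl ω X) -
          taaN (fun e => (p e : ℝ)) s y N X * condCov (fun e => (p e : ℝ)) {s} X g (ind {A : Set (Sym2 V) | y = s ∨ ∃ e ∈ A, y ∈ e}) (setCl ω X)) * ind (avoidEv s X) ω) =
        tab (fun e => (p e : ℝ)) s y X * (∑ ω, weight (fun e => (p e : ℝ)) ω *
          ((ind (missN N X)) (setCl ω X) * condCov (fun e => (p e : ℝ)) {s} X g (ind (hitN s N)) (setCl ω X) * ind (avoidEv s X) ω)) -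
          taaN (fun e => (p e : ℝ)) s y N X * ∑ ω, weight (fun e => (p e : ℝ)) ω * (condCov (fun e => (p e : ℝ)) {s} X g (ind {A : Set (Sym2 V) | y = s ∨ ∃ e ∈ A, y ∈ e}) (setCl ω X) * ind (avoidEv s X) ω) := by
      rw [Finset.mul_sum, Finset.mul_sum, ← Finset.sum_sub_distrib]
      exact Finset.sum_congr rfl fun ω _ => by ring
    rw [e0, esplit, hlin1, hlin2]
    have h5 := mul_le_mul_of_nonneg_left hZ hcE0
    have hX' := congrArg (fun t => taaN (fun e => (p e : ℝ)) s y N X * t) hX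
    linarith [h5, hX']
  -- the lower bound is `Q^N = taQN ≥ 0`
  have hQ : ∑ ω, weight (fun e => (p e : ℝ)) ω *
      ((tab (fun e => (p e : ℝ)) s y X * (ind (missN N X)) (setCl ω X) * condCov (fun e => (p e : ℝ)) {s} X g (ind (hitN s N)) (setCl ω X) -
        taaN (fun e => (p e : ℝ)) s y N X * condCov (fun e => (p e : ℝ)) {s} X g (ind {A : Set (Sym2 V) | y = s ∨ ∃ e ∈ A, y ∈ e}) (setCl ω X)) * ind (avoidEv s X) ω) ≥ taQN (fun e => (p e : ℝ)) s y N X g := by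
    have eQ : taQN (fun e => (p e : ℝ)) s y N X g = ∑ ω, weight (fun e => (p e : ℝ)) ω *
        ((tab (fun e => (p e : ℝ)) s y X * (taNWN (fun e => (p e : ℝ)) s y N X ω / taN (fun e => (p e : ℝ)) s y X ω * taC (fun e => (p e : ℝ)) s y X g ω) -
          taaN (fun e => (p e : ℝ)) s y N X * taC (fun e => (p e : ℝ)) s y X g ω) * ind (avoidEv s X) ω) := by
      have e1 : taAN (fun e => (p e : ℝ)) s y N X g * tab (fun e => (p e : ℝ)) s y X = ∑ ω, weight (fun e => (p e : ℝ)) ω *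
          (tab (fun e => (p e : ℝ)) s y X * (taNWN (fun e => (p e : ℝ)) s y N X ω / taN (fun e => (p e : ℝ)) s y X ω * taC (fun e => (p e : ℝ)) s y X g ω) * ind (avoidEv s X) ω) := by
        rw [taAN, Finset.sum_mul]
        exact Finset.sum_congr rfl fun ω _ => by ring
      have e2 : taaN (fun e => (p e : ℝ)) s y N X * taB (fun e => (p e : ℝ)) s y X g = ∑ ω, weight (fun e => (p e : ℝ)) ω *
          (taaN (fun e => (p e : ℝ)) s y N X * taC (fun e => (p e : ℝ)) s y X g ω * ind (avoidEv s X) ω) := by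
        rw [taB, Finset.mul_sum]
        exact Finset.sum_congr rfl fun ω _ => by ring
      rw [taQN, e1, e2, ← Finset.sum_sub_distrib]
      exact Finset.sum_congr rfl fun ω _ => by ring
    rw [eQ]
    refine Finset.sum_le_sum fun ω _ => mul_le_mul_of_nonneg_left ?_ (weight_nonneg hw0 hw1 ω)
    refine mul_le_mul_of_nonneg_right ?_ (ind_nonneg _ _)
    have h1 := setObs_condCov_ge p s y hsy N X g hg hg0 ω
    have h2 := condCov_chi_eq_taC (fun e => (p e : ℝ)) s y X g ω
    rw [h2]
    have h3 := mul_le_mul_of_nonneg_left h1 hcE0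
    linarith
  have hQ0 : 0 ≤ taQN (fun e => (p e : ℝ)) s y N X g := taQN_nonneg s y hsy N g hg hg0 p hp X
  have hfin : (∑ ω, weight (fun e => (p e : ℝ)) ω * ind (avoidEv s X) ω) * 0 ≤ (∑ ω, weight (fun e => (p e : ℝ)) ω * ind (avoidEv s X) ω) * withinD (fun e => (p e : ℝ)) {s} X (avoidEv s X) g (fun A => tab (fun e => (p e : ℝ)) s y X * zetaBarN (fun e => (p e : ℝ)) s N X A - taaN (fun e => (p e : ℝ)) s y N X * (ind {A : Set (Sym2 V) | y = s ∨ ∃ e ∈ A, y ∈ e}) A) := by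
    rw [mul_zero]
    exact le_trans (mul_nonneg hμD0 (le_trans hQ0 hQ)) key
  exact le_of_mul_le_mul_left hfin hμDpos

end TANWithin

end HullPort

end Summit.CriticalPhenomena.PercolationContinuityZ3.Theorems
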